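import Mathlib
import HarnessLib
import Summits.ValiantsHypothesis.ValiantsHypothesis.Theses.MonotoneRestoration
import Literature.Computability.AlgebraicComplexity.ArithCircuit
import Literature.Computability.AlgebraicComplexity.ArithCircuitProofs
import Literature.Computability.AlgebraicComplexity.MonotoneStructure
import Literature.Computability.AlgebraicComplexity.PermanentIrreducible
import Literature.ModelTheory.FiniteModelTheory.CkEquiv
import Summits.ValiantsHypothesis.ValiantsHypothesis.Theorems.MonotoneRestorationMonotoneRestorationQPCosetCount
import Summits.ValiantsHypothesis.ValiantsHypothesis.Theorems.MonotoneRestorationMonotoneRestorationQPSymmetricLB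
import Summits.ValiantsHypothesis.ValiantsHypothesis.Theorems.MonotoneRestorationMonotoneRestorationQPSupportSymmetrisation
import Summits.ValiantsHypothesis.ValiantsHypothesis.Theorems.MonotoneRestorationMonotoneRestorationQPSparseRegime
import Summits.ValiantsHypothesis.ValiantsHypothesis.Theorems.MonotoneRestorationMonotoneRestorationQPBeta
import Literature.Computability.AlgebraicComplexity.SymmetricArithCircuit
import Literature.Computability.AlgebraicComplexity.DawarWilsenach2025Proofs
import Literature.GroupTheory.PermutationGroups.SmallIndexSubgroups
import Summits.ValiantsHypothesis.ValiantsHypothesis.Theorems.MonotoneRestorationQP.Negative.LoadBearing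
import Summits.ValiantsHypothesis.ValiantsHypothesis.Theorems.MonotoneRestorationMonotoneRestorationQPPermSupportCount

/-! TTRL-lite variant V19984 of stmt-ValiantsHypothesis-15886 -/

/-!
Degree bookkeeping atom of the registered proof of `stub_symmetricMonotone_choose_le_card`:
a row-multilinear monomial `μ` in the doubly indexed variables `x_{i,j}` (every row degree
`≤ 1`) all of whose nonzero rows lie in a row set `X` has degree `≤ |X|` — the degree of `μ` is
the sum of its row degrees (`degree_rowDegrees`), each `≤ 1`, over a support contained in `X`.
-/

-- `Summit.ValiantsHypothesis.ValiantsHypothesis.…` is the tree's mandated single-conjunct layout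
-- (Sub = Summit), so the duplicated namespace component is intended.
set_option linter.dupNamespace false

namespace Summit.ValiantsHypothesis.ValiantsHypothesis.Theorems

open Summit.ValiantsHypothesis.ValiantsHypothesis.Theses.MonotoneRestoration
open Literature.Computability.AlgebraicComplexity

/-- TTRL-lite variant V19984 of `stub_symmetricMonotone_choose_le_card`
(`stmt-ValiantsHypothesis-15886`): a row-multilinear monomial `μ` in the variables `x_{i,j}`
(all row degrees `≤ 1`) whose nonzero rows all lie in `X` has degree at most `|X|`.
[folklore] -/
theorem stub_symmetricMonotone_choose_le_card_var19984 :
    ∀ (n : ℕ) (X : Finset (Fin n)) (μ : Fin n × Fin n →₀ ℕ),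
      (∀ i : Fin n, rowDegrees μ i ≤ 1) → (∀ i : Fin n, rowDegrees μ i ≠ 0 → i ∈ X) →
      μ.degree ≤ X.card := by
  intro n X μ h1 hX
  rw [← degree_rowDegrees, Finsupp.degree_apply]
  calc ∑ i ∈ (rowDegrees μ).support, rowDegrees μ i
      ≤ ∑ i ∈ (rowDegrees μ).support, 1 := Finset.sum_le_sum fun i _ => h1 i
    _ = (rowDegrees μ).support.card := by simp
    _ ≤ X.card := Finset.card_le_card fun i hi => hX i (Finsupp.mem_support_iff.1 hi)

end Summit.ValiantsHypothesis.ValiantsHypothesis.Theorems
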